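import Literature.AlgebraicGeometry.AbelianSchemes.SerreTensorFunctoriality
import Literature.AlgebraicGeometry.AbelianSchemes.AbelianSchemeFixedPowBaseChange
import HarnessLib

/-!
# Base change of Serre's tensor construction: `(A ⊗_𝒪 𝔟)_{S'} ≅ A_{S'} ⊗_𝒪 𝔟`, compatibly with the inclusions into `(A_{S'})ⁿ`
# and with the `𝒪`-actions

Topic `AlgebraicGeometry/AbelianSchemes`, namespace `Literature.AlgebraicGeometry.AbelianSchemes.AbelianSchemeOver` (constructions with
bodies + proved theorems; no named fact, no `sorry`, no `instance`, no notation; any base change `g : S' ⟶ S`).  Cell `hodgecm-mathlib`,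
F0/P6 «MOD», P6a organ (g2) FILE 4b over FILE 3 ★∕`SerreTensorFunctoriality` and FILE 4a `AbelianSchemeFixedPowBaseChange`;
`--supports stmt-HodgeConjecture-24832`, count-neutral.  HC_CM is proved only modulo the 2 remaining named inputs (hLiu418, h413) until
rung 0 closes; this file discharges none of them.

## Mathematics (B. Conrad, *Gross–Zagier revisited* §7: `M ⊗_R A` commutes with base change, as it represents `T ↦ M ⊗_R A(T)`)

With `A ⊗_𝒪 𝔟 := Fix([E] ↷ Aⁿ)` (★ FILE 2): `(A ⊗_𝒪 𝔟)_{S'} = Fix([E])_{S'} ≅ Fix([E]_{S'})` (★ FILE 4a `fixedBaseChangeIso`), and under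
`(Aⁿ)_{S'} ≅ (A_{S'})ⁿ` (★ `powBaseChangeIso`) the endomorphism `[E]_{S'}` corresponds to the matrix endomorphism `[E]'` of `(A_{S'})ⁿ`
for the base-changed action (§1: base change preserves products of points, `Functor.map_mul`), so ★ FILE 3 `fixedHom` along the two
inverse intertwiners gives `Fix([E]_{S'}) ≅ Fix([E]') = A_{S'} ⊗_𝒪 𝔟` (§2).  The composite isomorphism is a homomorphism in both
directions, commutes with the inclusions (`iso.hom ≫ ι' = ι_{S'} ≫ powBC`) and is `𝒪`-equivariant.  All statements are typed on the
`Fix` carriers; `serreTensor_baseChange_X`, `serreTensorBC_X`, `serreι_baseChange_eq`, `serreAction_i_eq` record (by `rfl`) that these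
ARE the carriers ∕ inclusion ∕ action of `(serreTensor act E hE).baseChange g` and `serreTensor (act.baseChange g) E hE`.

## Contents

* §1 `isCommMonObj_baseChange`, `pullback_map_finset_prod`, `matrixEndBC` (`= [M]'`), **`endBC_matrixEnd_comp_powBC :
  endBC g (matrixEnd act M) ≫ powBC g A n = powBC g A n ≫ matrixEndBC g act M`**, `powBCInv_comp_endBC_matrixEnd`;
* §2 `serreTensorBC`, `fixedEBC`, `fixedE'`, the `rfl` bookkeeping above, `serreBCHom∕serreBCInv` (`serreBCHom_inv`),
  **`serreTensorBaseChangeIso`** (+ the identically-typed `serreTensorBaseChangeIso'` on the Serre-tensor carriers),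
  `serreTensorBaseChangeIso_hom_ι`, `isMonHom_serreTensorBaseChangeIso`, **`serreTensorBaseChangeIso_equivariant`**.

## References
* [Conrad2004GrossZagier] B. Conrad, *Gross–Zagier revisited*, MSRI Publ. 49 (2004), §7.
* [GortzWedhorn2020] Section (4.7) (pp. 107–108); [Kottwitz1992] §5 (p. 390).
* Tree: ★ FILE 2 `SerreTensorConstruction`, FILE 3 `SerreTensorFunctoriality`, FILE 4a `AbelianSchemeFixedPowBaseChange`.
-/

noncomputable section

universe u

open CategoryTheory CategoryTheory.Limits AlgebraicGeometry MonoidalCategory CartesianMonoidalCategory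
open scoped MonObj CategoryTheory.Obj

namespace Literature.AlgebraicGeometry.AbelianSchemes

namespace AbelianSchemeOver

variable {S S' : Scheme.{u}} (g : S' ⟶ S) {A : AbelianSchemeOver S} {O : Type*} [CommRing O] (act : A.RingAction O)
  [IsCommMonObj A.X] {n : ℕ}

/-! ## §1 The matrix action commutes with base change: `[M]_{S'} ≫ powBC = powBC ≫ [M]'` -/

/-- `A_{S'}` is commutative when `A` is (a monoidal functor preserves commutativity). [cite: GortzWedhorn2020, Section (4.7) (pp. 107–108)] -/
theorem isCommMonObj_baseChange : IsCommMonObj (A.baseChange g).X :=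
  inferInstanceAs (IsCommMonObj ((Over.pullback g).obj A.X))

/-- Base change takes finite products in the group of points to finite products. [cite: GortzWedhorn2020, Section (4.7) (pp. 107–108)] -/
theorem pullback_map_finset_prod {T : Over S} {κ : Type*} (s : Finset κ) (f : κ → (T ⟶ A.X)) :
    ((Over.pullback g).map (∏ k ∈ s, f k) : (Over.pullback g).obj T ⟶ (A.baseChange g).X) =
      ∏ k ∈ s, ((Over.pullback g).map (f k) : (Over.pullback g).obj T ⟶ (A.baseChange g).X) :=
  map_prod (Functor.homMonoidHom (Over.pullback g)) f s

/-- The matrix endomorphism `[M]'` of `(A_{S'})ⁿ` for the base-changed action (the commutativity instance of `A_{S'}` supplied by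
name). [cite: Kottwitz1992, §5 (p. 390)] -/
abbrev matrixEndBC (M : Matrix (Fin n) (Fin n) O) : ((A.baseChange g).pow n).X ⟶ ((A.baseChange g).pow n).X :=
  @matrixEnd S' (A.baseChange g) O _ (act.baseChange g) (isCommMonObj_baseChange g) n M

/-- **`[M]_{S'} ≫ powBC = powBC ≫ [M]'`**: under `(Aⁿ)_{S'} ≅ (A_{S'})ⁿ` the base change of the matrix endomorphism `[M]` of `Aⁿ`
is the matrix endomorphism of `(A_{S'})ⁿ` for the base-changed action. [cite: Kottwitz1992, §5 (p. 390)] -/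
theorem endBC_matrixEnd_comp_powBC (M : Matrix (Fin n) (Fin n) O) :
    endBC g (B := A.pow n) (matrixEnd act M) ≫ powBC g A n = powBC g A n ≫ matrixEndBC g act M := by
  haveI := isCommMonObj_baseChange g (A := A)
  apply pow_hom_ext
  intro k
  have hR := congrFun (powHomEquiv_comp_matrixEnd (act.baseChange g) M (powBC g A n)) k
  rw [powHomEquiv_apply] at hR
  rw [hR, Category.assoc, powBC_powProj]
  have hL : endBC g (B := A.pow n) (matrixEnd act M) ≫ powProjBC g A n k =
      (Over.pullback g).map (matrixEnd act M ≫ A.powProj n k) := ((Over.pullback g).map_comp _ _).symm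
  rw [hL, ← powHomEquiv_apply (matrixEnd act M), powHomEquiv_matrixEnd]
  unfold matrixComp
  rw [pullback_map_finset_prod]
  refine Finset.prod_congr rfl fun j _ => ?_
  rw [Functor.map_comp, powHomEquiv_apply, powBC_powProj]
  rfl

/-- `powBCInv` intertwines `[M]'` and `[M]_{S'}`. [cite: Kottwitz1992, §5 (p. 390)] -/
theorem powBCInv_comp_endBC_matrixEnd (M : Matrix (Fin n) (Fin n) O) :
    powBCInv g A n ≫ endBC g (B := A.pow n) (matrixEnd act M) = matrixEndBC g act M ≫ powBCInv g A n := by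
  calc powBCInv g A n ≫ endBC g (B := A.pow n) (matrixEnd act M)
      = (powBCInv g A n ≫ endBC g (B := A.pow n) (matrixEnd act M)) ≫ (powBC g A n ≫ powBCInv g A n) := by
        rw [powBC_comp_powBCInv, Category.comp_id]
    _ = powBCInv g A n ≫ (endBC g (B := A.pow n) (matrixEnd act M) ≫ powBC g A n) ≫ powBCInv g A n := by
        simp only [Category.assoc]
    _ = matrixEndBC g act M ≫ powBCInv g A n := by
        rw [endBC_matrixEnd_comp_powBC, Category.assoc, powBCInv_comp_powBC_assoc]

/-! ## §2 `(A ⊗_𝒪 𝔟)_{S'} ≅ A_{S'} ⊗_𝒪 𝔟` -/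

variable (E : Matrix (Fin n) (Fin n) O) (hE : E * E = E)

/-- The base-changed Serre tensor construction, with the base-changed action: `A_{S'} ⊗_𝒪 𝔟`. [cite: Conrad2004GrossZagier, §7] -/
abbrev serreTensorBC : AbelianSchemeOver S' :=
  @serreTensor S' (A.baseChange g) O _ (act.baseChange g) (isCommMonObj_baseChange g) n E hE

/-- `Fix([E]_{S'})` on `(Aⁿ)_{S'}` (instance supplied by name). [cite: Conrad2004GrossZagier, §7] -/
abbrev fixedEBC : Over S' := @fixedOverBC S S' g (A.pow n) (matrixEnd act E) (isMonHom_matrixEnd act E)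

/-- `Fix([E]')` on `(A_{S'})ⁿ` — the carrier of `A_{S'} ⊗_𝒪 𝔟` (instances supplied by name). [cite: Conrad2004GrossZagier, §7] -/
abbrev fixedE' : Over S' :=
  @fixedOver S' ((A.baseChange g).pow n) (matrixEndBC g act E)
    (@isMonHom_matrixEnd S' (A.baseChange g) O _ (act.baseChange g) (isCommMonObj_baseChange g) n E)

/-- The carrier of `A_{S'} ⊗_𝒪 𝔟` IS `Fix([E]')` (definitional bookkeeping). [cite: Conrad2004GrossZagier, §7] -/
theorem serreTensorBC_X : (serreTensorBC g act E hE).X = fixedE' g act E := rfl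

/-- The carrier of `(A ⊗_𝒪 𝔟)_{S'}` IS `(Fix([E]))_{S'}` (definitional bookkeeping). [cite: Conrad2004GrossZagier, §7] -/
theorem serreTensor_baseChange_X :
    ((serreTensor act E hE).baseChange g).X =
      ((@fixed S (A.pow n) (matrixEnd act E) (isMonHom_matrixEnd act E) (matrixEnd_idem act hE)).baseChange g).X := rfl

/-- The comparison `Fix([E]_{S'}) ⟶ Fix([E]')` induced by `powBC` (★ `fixedHom`). [cite: Conrad2004GrossZagier, §7] -/
def serreBCHom : fixedEBC g act E ⟶ fixedE' g act E :=
  @fixedHom S' ((A.pow n).baseChange g) ((A.baseChange g).pow n) (endBC g (B := A.pow n) (matrixEnd act E))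
    (@isMonHom_endBC S S' g (A.pow n) (matrixEnd act E) (isMonHom_matrixEnd act E)) (matrixEndBC g act E)
    (@isMonHom_matrixEnd S' (A.baseChange g) O _ (act.baseChange g) (isCommMonObj_baseChange g) n E)
    (@matrixEnd_idem S' (A.baseChange g) O _ (act.baseChange g) (isCommMonObj_baseChange g) n E hE) (powBC g A n)

/-- The inverse comparison `Fix([E]') ⟶ Fix([E]_{S'})` induced by `powBCInv`. [cite: Conrad2004GrossZagier, §7] -/
def serreBCInv : fixedE' g act E ⟶ fixedEBC g act E :=
  @fixedHom S' ((A.baseChange g).pow n) ((A.pow n).baseChange g) (matrixEndBC g act E)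
    (@isMonHom_matrixEnd S' (A.baseChange g) O _ (act.baseChange g) (isCommMonObj_baseChange g) n E)
    (endBC g (B := A.pow n) (matrixEnd act E))
    (@isMonHom_endBC S S' g (A.pow n) (matrixEnd act E) (isMonHom_matrixEnd act E))
    (endBC_idem g _ (matrixEnd_idem act hE)) (powBCInv g A n)

/-- `serreBCHom ≫ serreBCInv = 𝟙` and `serreBCInv ≫ serreBCHom = 𝟙`. [cite: Conrad2004GrossZagier, §7] -/
theorem serreBCHom_inv :
    serreBCHom g act E hE ≫ serreBCInv g act E hE = 𝟙 _ ∧ serreBCInv g act E hE ≫ serreBCHom g act E hE = 𝟙 _ := by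
  haveI := isCommMonObj_baseChange g (A := A)
  haveI hmE : IsMonHom (matrixEndBC g act E) := isMonHom_matrixEnd (act.baseChange g) E
  haveI := isMonHom_matrixEnd act E
  haveI := @isMonHom_endBC S S' g (A.pow n) (matrixEnd act E) (isMonHom_matrixEnd act E)
  have hid1 := fixedHom_id (endBC g (B := A.pow n) (matrixEnd act E)) (endBC_idem g _ (matrixEnd_idem act hE))
  have hid2 := fixedHom_id (matrixEndBC g act E) (matrixEnd_idem (act.baseChange g) hE)
  rw [← powBC_comp_powBCInv] at hid1
  rw [← powBCInv_comp_powBC] at hid2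
  rw [fixedHom_comp (endBC g (B := A.pow n) (matrixEnd act E)) (matrixEndBC g act E) (matrixEnd_idem (act.baseChange g) hE)
    (powBC g A n) (endBC_matrixEnd_comp_powBC g act E).symm (endBC g (B := A.pow n) (matrixEnd act E))
    (endBC_idem g _ (matrixEnd_idem act hE)) (powBCInv g A n) (powBCInv_comp_endBC_matrixEnd g act E)] at hid1
  rw [fixedHom_comp (matrixEndBC g act E) (endBC g (B := A.pow n) (matrixEnd act E)) (endBC_idem g _ (matrixEnd_idem act hE))
    (powBCInv g A n) (powBCInv_comp_endBC_matrixEnd g act E) (matrixEndBC g act E) (matrixEnd_idem (act.baseChange g) hE)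
    (powBC g A n) (endBC_matrixEnd_comp_powBC g act E).symm] at hid2
  exact ⟨hid1, hid2⟩

/-- **`(A ⊗_𝒪 𝔟)_{S'} ≅ A_{S'} ⊗_𝒪 𝔟`** (as `S'`-schemes, typed on the `Fix` carriers — see `serreTensor_baseChange_X`,
`serreTensorBC_X` for the definitional identifications): `Fix([E])_{S'} ≅ Fix([E]_{S'})` (★ `fixedBaseChangeIso`) followed by
`Fix([E]_{S'}) ≅ Fix([E]')` along `(Aⁿ)_{S'} ≅ (A_{S'})ⁿ`. [cite: Conrad2004GrossZagier, §7] -/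
def serreTensorBaseChangeIso :
    ((@fixed S (A.pow n) (matrixEnd act E) (isMonHom_matrixEnd act E) (matrixEnd_idem act hE)).baseChange g).X ≅
      fixedE' g act E :=
  (@fixedBaseChangeIso S S' g (A.pow n) (matrixEnd act E) (isMonHom_matrixEnd act E) (matrixEnd_idem act hE)) ≪≫
    { hom := serreBCHom g act E hE
      inv := serreBCInv g act E hE
      hom_inv_id := (serreBCHom_inv g act E hE).1
      inv_hom_id := (serreBCHom_inv g act E hE).2 }

/-- The same isomorphism typed on the Serre-tensor carriers `((A ⊗_𝒪 𝔟)_{S'}).X ≅ (A_{S'} ⊗_𝒪 𝔟).X` (definitionally equal types).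
[cite: Conrad2004GrossZagier, §7] -/
def serreTensorBaseChangeIso' : ((serreTensor act E hE).baseChange g).X ≅ (serreTensorBC g act E hE).X :=
  serreTensorBaseChangeIso g act E hE

/-- `ι'` of `A_{S'} ⊗_𝒪 𝔟` IS `ι` of `Fix([E]')` (definitional bookkeeping). [cite: Conrad2004GrossZagier, §7] -/
theorem serreι_baseChange_eq :
    @serreι S' (A.baseChange g) O _ (act.baseChange g) (isCommMonObj_baseChange g) n E hE =
      @fixedι S' ((A.baseChange g).pow n) (matrixEndBC g act E)
        (@isMonHom_matrixEnd S' (A.baseChange g) O _ (act.baseChange g) (isCommMonObj_baseChange g) n E) := rfl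

/-- The base-change isomorphism is compatible with the inclusions: `iso.hom ≫ ι' = ι_{S'} ≫ powBC`. [cite: Conrad2004GrossZagier, §7] -/
@[reassoc]
theorem serreTensorBaseChangeIso_hom_ι :
    (serreTensorBaseChangeIso g act E hE).hom ≫
        @fixedι S' ((A.baseChange g).pow n) (matrixEndBC g act E)
          (@isMonHom_matrixEnd S' (A.baseChange g) O _ (act.baseChange g) (isCommMonObj_baseChange g) n E) =
      @ιBC S S' g (A.pow n) (matrixEnd act E) (isMonHom_matrixEnd act E) (matrixEnd_idem act hE) ≫ powBC g A n := by
  haveI := isMonHom_matrixEnd act E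
  haveI := isCommMonObj_baseChange g (A := A)
  haveI := isMonHom_matrixEnd (act.baseChange g) E
  haveI := @isMonHom_endBC S S' g (A.pow n) (matrixEnd act E) (isMonHom_matrixEnd act E)
  change ((fixedBaseChangeIso g (B := A.pow n) (matrixEnd act E) (matrixEnd_idem act hE)).hom ≫ serreBCHom g act E hE) ≫ _ = _
  rw [Category.assoc]
  unfold serreBCHom
  rw [fixedHom_ι _ _ _ _ (endBC_matrixEnd_comp_powBC g act E).symm, fixedBaseChangeIso_hom_ι_assoc]

/-- Both directions of `(A ⊗_𝒪 𝔟)_{S'} ≅ A_{S'} ⊗_𝒪 𝔟` are homomorphisms. [cite: Conrad2004GrossZagier, §7] -/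
theorem isMonHom_serreTensorBaseChangeIso :
    IsMonHom (serreTensorBaseChangeIso g act E hE).hom ∧ IsMonHom (serreTensorBaseChangeIso g act E hE).inv := by
  haveI := isMonHom_matrixEnd act E
  haveI := isCommMonObj_baseChange g (A := A)
  haveI := isMonHom_matrixEnd (act.baseChange g) E
  haveI := @isMonHom_endBC S S' g (A.pow n) (matrixEnd act E) (isMonHom_matrixEnd act E)
  haveI h : IsMonHom (serreTensorBaseChangeIso g act E hE).hom := by
    haveI := (isMonHom_fixedBaseChangeIso g (B := A.pow n) (matrixEnd act E) (matrixEnd_idem act hE)).1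
    haveI := isMonHom_powBC g A n
    haveI : IsMonHom (serreBCHom g act E hE) := by
      unfold serreBCHom
      exact isMonHom_fixedHom _ _ _ _
    change IsMonHom ((fixedBaseChangeIso g (B := A.pow n) (matrixEnd act E) (matrixEnd_idem act hE)).hom ≫ serreBCHom g act E hE)
    infer_instance
  exact ⟨h, inferInstance⟩

/-- `ι(a)` of `A ⊗_𝒪 𝔟` IS `[a·1]|_{Fix([E])}` (definitional bookkeeping). [cite: Conrad2004GrossZagier, §7] -/
theorem serreAction_i_eq (a : O) :
    (serreAction act E hE).i a =
      @fixedMap S (A.pow n) (matrixEnd act E) (isMonHom_matrixEnd act E) (matrixEnd_idem act hE)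
        (matrixEnd act (Matrix.scalar (Fin n) a)) := rfl

/-- **The base-change isomorphism is `𝒪`-equivariant**: `(ι(a))_{S'} ≫ iso.hom = iso.hom ≫ ι'(a)` with `ι(a) = [a·1]|_{Fix([E])}`,
`ι'(a) = [a·1]'|_{Fix([E]')}` (= `serreAction (act.baseChange g)` by `serreAction_i_eq`). [cite: Conrad2004GrossZagier, §7] -/
theorem serreTensorBaseChangeIso_equivariant (a : O) :
    endBC g (B := @fixed S (A.pow n) (matrixEnd act E) (isMonHom_matrixEnd act E) (matrixEnd_idem act hE))
          (@fixedMap S (A.pow n) (matrixEnd act E) (isMonHom_matrixEnd act E) (matrixEnd_idem act hE)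
            (matrixEnd act (Matrix.scalar (Fin n) a))) ≫ (serreTensorBaseChangeIso g act E hE).hom =
      (serreTensorBaseChangeIso g act E hE).hom ≫
        @fixedMap S' ((A.baseChange g).pow n) (matrixEndBC g act E)
          (@isMonHom_matrixEnd S' (A.baseChange g) O _ (act.baseChange g) (isCommMonObj_baseChange g) n E)
          (@matrixEnd_idem S' (A.baseChange g) O _ (act.baseChange g) (isCommMonObj_baseChange g) n E hE)
          (matrixEndBC g act (Matrix.scalar (Fin n) a)) := by
  haveI := isMonHom_matrixEnd act E
  haveI := isCommMonObj_baseChange g (A := A)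
  haveI := isMonHom_matrixEnd (act.baseChange g) E
  haveI : Mono (@fixedι S' ((A.baseChange g).pow n) (matrixEndBC g act E)
      (@isMonHom_matrixEnd S' (A.baseChange g) O _ (act.baseChange g) (isCommMonObj_baseChange g) n E)) := mono_fixedι _
  have hsc : matrixEndBC g act (Matrix.scalar (Fin n) a) ≫ matrixEndBC g act E =
      matrixEndBC g act E ≫ matrixEndBC g act (Matrix.scalar (Fin n) a) := matrixEnd_scalar_comm (act.baseChange g) E a
  rw [← cancel_mono (@fixedι S' ((A.baseChange g).pow n) (matrixEndBC g act E)
      (@isMonHom_matrixEnd S' (A.baseChange g) O _ (act.baseChange g) (isCommMonObj_baseChange g) n E)),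
    Category.assoc, serreTensorBaseChangeIso_hom_ι, Category.assoc, fixedMap_ι _ _ _ hsc, serreTensorBaseChangeIso_hom_ι_assoc]
  have h1 : endBC g (B := @fixed S (A.pow n) (matrixEnd act E) (isMonHom_matrixEnd act E) (matrixEnd_idem act hE))
        (@fixedMap S (A.pow n) (matrixEnd act E) (isMonHom_matrixEnd act E) (matrixEnd_idem act hE)
          (matrixEnd act (Matrix.scalar (Fin n) a))) ≫
      @ιBC S S' g (A.pow n) (matrixEnd act E) (isMonHom_matrixEnd act E) (matrixEnd_idem act hE) =
        @ιBC S S' g (A.pow n) (matrixEnd act E) (isMonHom_matrixEnd act E) (matrixEnd_idem act hE) ≫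
          endBC g (B := A.pow n) (matrixEnd act (Matrix.scalar (Fin n) a)) := by
    change (Over.pullback g).map _ ≫ (Over.pullback g).map _ = (Over.pullback g).map _ ≫ (Over.pullback g).map _
    rw [← Functor.map_comp, ← Functor.map_comp]
    exact congrArg _ (fixedMap_ι (matrixEnd act E) (matrixEnd_idem act hE) _ (matrixEnd_scalar_comm act E a))
  rw [← Category.assoc, h1, Category.assoc, endBC_matrixEnd_comp_powBC]

end AbelianSchemeOver

end Literature.AlgebraicGeometry.AbelianSchemes

end
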